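import Summits.QuantumFields.BalabanUV.Beta.FP.TowerDoorDefectDefs
import Summits.QuantumFields.BalabanUV.Beta.FP.TowerDoorGaugeRefDefs
import Summits.QuantumFields.BalabanUV.Beta.CompositeOneShotJets
import Literature.MathematicalPhysics.QuantumFieldTheory.Balaban1983to89.Beta.KernelSpecInstance

/-!
# `BalabanUV.Beta.FP.TowerDoorRecordDefs` — binder row D1, the row's ONE file, THE RECORD INSTANCE OF THE DOOR (J-NOTE-21 §7 (C), road W-4∕W-5: Q-an2-77-1 (a), Q-an2-77-2 yes∕yes∕no objection):
# **v10's door letters PINNED — `lamd`, `Sd`, the functional's weight, and `𝒲Δ` — as the record instances of PART 55's `lamZ` and PART 62's `doorZ`∕`defKerZ`**, over v10's own displayed scalars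
# (`Pn : Pins`, the sequences `sn cS κ₂ κτ : ℕ → ℝ`): at door index `j = n+1`, blocking `L = Lc^(n+2)`, tables `tabsComp (n+2) … (Pn.cM (n+2))`, chart `scaleK σₙ σₙ (AN (Roots.ctr Lc) (n+1))` with
# `σₙ = Sum.elim 1 (sn n)⁻¹` (v10's leg), root list `fun _ => ctrOff 4 Lc`, levels `fun i => n + 1 − i` (v10's `hQ₁₀`), read-out weight `cS n · wΦ κ ν (y₀ − z)` (PART 46's `Sd`)
# (β-function cell `pub-balaban`, BINDER-OWNERS row D1 ∕ (C1) OWNER «beta-an2» gen 77, PART 69; imports PART 62 + PART 55 + `CompositeOneShotJets` + lit `KernelSpecInstance`)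

WHAT ([our object — bookkeeping] five `def`s + [folklore] unfoldings and v10's three `ff`∕swap letters AT THE INSTANCE; no `def … : Prop`, nothing cited, 0 sorry, default heartbeats).
* `lamRec Lc sn n μ y : Site 4 → ℝ` — `λℤ_(μ,y)` at door index `n+1` for the `σₙ`-conjugated record chart (PART 55 `lamZ` at v10's `lev`, `rs`, `hrs`);
* `SRec Lc cS n ν z κ y₀ := cS · wΦ (N := Lc^(n+2)) κ ν (y₀ − z)` — PART 46's read-out column in p670056 §5's argument order;
* `tabsRec Lc Pn n := tabsComp (n+2) _ (Roots.ctr Lc).hr (Pn.cM (n+2))` — v10's table record at the door's depth (`hM₂`, (T2)'s `Ĉ`);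
* `omegaRec Lc Pn κ₂ n κ u := tadpole (AN (Roots.ctr Lc) (n+1)) (defKerZ (Lc^(n+2)) (tabsRec …) κ₂ (Pi.single u 1) (0, κ))` — the door functional's weight at the window `(0, κ)` (PART 67∕68: the
  functional IS `l1Pairing` of `omegaRec (· − L•y)`);
* `doorRec Lc Pn sn cS κ₂ κτ : ℕ → Fin 4 → Site 4 → Fin 4 → Site 4 → MKer 4 (Fib 3)` — **v10's `𝒲Δ`**: `0` at door index `0`, `doorZ (Lc^(n+2)) (tabsRec n) (κ₂ n) (κτ n) (lamRec (sn n) n) (SRec (cS n) n)` at `n+1`.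
* [folklore] `doorRec_zero`, `doorRec_succ`, **`doorRec_inr_left` ∕ `doorRec_inr_right` ∕ `doorRec_swap`** — v10's `hWΔm`, `hWΔm′`, `hWΔs` letters AT THE INSTANCE, in v10's quantifier shape (every `j`).
WHAT THIS IS NOT: not `hWΔ₂` (the instance's bi-localisation — PART 64 + PART 59's extra decay + a window summation), not `hX hτ hτa hΘ` at the instance (compositions of PART 57∕58∕60∕61∕65∕67∕68 with the rates of
`decays_AN`∕`(tabsRec).hmix` aligned — next file), not (T2); `κτ`, `cS`, `κ₂`, `sn` are v10's DISPLAYED scalars, NOT valued here; nothing of Bałaban's asserted, valued or discharged; 0 estimates; 0∕4 row-D1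
binders (hW, hR, D1Tel, D1Rep); v10 NOT filed; v9 p617999 stands; NOT (C1), NOT (T-ID), NOT D1, NEVER «G-an2-4 closed», NOT BetaPertH, NOT continuum, NOT Clay.

HONEST DEPENDENCY (page 1, mandatory): continuum YM on T⁴ ⇐ BetaPertH ∧ nine spine estimates (0/9 proved); BetaPertH ⇐ (D1) ∧ (D4) ∧ CAP+tail;
G-an2-4 gates asym, D1 and NE2/3/4.  HONEST FRAMING (cell contract, verbatim): «discharging `BetaPertH` makes Bałaban's UV stability UNCONDITIONAL —
a real constructive-QFT result; it is NOT the continuum limit and NOT the Clay problem.»  ABSOLUTE RULE (cell charter, verbatim): «No internally-minted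
statement may enter as a cited fact. Every hypothesis is either kernel-proved in this package or a verbatim quotation of a PUBLISHED theorem with page
reference. The manuscript(s) under audit are NOT citable for their own disputed steps — they are the thing under adjudication; programme-internal
(2001/route/tribunal) claims are never citable.»  Row D1 ∕ (C1) OWNER «beta-an2» gen 77, 2026-08-29.  No existing file touched.
-/

noncomputable section

open Finset
open scoped BigOperators
open Literature.MathematicalPhysics.QuantumFieldTheory
open Literature.MathematicalPhysics.QuantumFieldTheory.Balaban1983to89
open Literature.MathematicalPhysics.QuantumFieldTheory.Balaban1983to89.Beta
open AffineAveraging (Site box toSite unitVec)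
open AveragingContoursRooted (ctrOff ctrOff_mem_box)
open OneStepResolventKernel (Fib)
open ExpKernelCalculus (MKer tadpole)
open HessKerRate (scaleK)
open KernelSpecInstance (wΦ)
open Summit.QuantumFields.BalabanUV.Beta.SymmetrisedStepJets (SymTables)
open Summit.QuantumFields.BalabanUV.Beta.CompositeOneShotJets (tabsComp)
open Summit.QuantumFields.BalabanUV.Beta.CompositeOneShotJetData (Roots Roots.ctr Pins AN)
open Summit.QuantumFields.BalabanUV.Beta.GAN24.FineReadoutCauchyFrame (toSite_mem_range)
open Summit.QuantumFields.BalabanUV.Beta.FP.TowerDoorGaugeRefDefs (lamZ)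
open Summit.QuantumFields.BalabanUV.Beta.FP.TowerDoorDefectDefs

namespace Summit.QuantumFields.BalabanUV.Beta.FP.TowerDoorRecordDefs

/-! ## §1 The five definitions -/

section Defs

variable (Lc : ℕ) [NeZero Lc]

/-- [our object — bookkeeping] **`lamd` OF v10 — THE LATTICE GAUGE FUNCTION OF THE RECORD at door index `n+1`**: PART 55's `lamZ` at v10's levels `fun i => n + 1 − i`, the centred root list,
its displayed membership proof, and the `σₙ`-conjugated record chart `scaleK σₙ σₙ (AN (Roots.ctr Lc) (n+1))`, `σₙ = Sum.elim 1 sn⁻¹` (`sn` = v10's `sn n`). -/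
def lamRec (sn : ℝ) (n : ℕ) (μ : Fin (3 + 1)) (y : Site (3 + 1)) : Site (3 + 1) → ℝ :=
  lamZ Lc (fun i : ℕ => n + 1 - i) (fun _ : ℕ => ctrOff (3 + 1) Lc)
    (fun _ => toSite_mem_range (ctrOff_mem_box (d := 3 + 1) (Nat.one_le_iff_ne_zero.mpr (NeZero.ne Lc)))) n
    (scaleK (Sum.elim (fun _ : Fin (3 + 1) => (1 : ℝ)) (fun _ : Fin (3 + 1) => sn⁻¹)) (Sum.elim (fun _ : Fin (3 + 1) => (1 : ℝ)) (fun _ : Fin (3 + 1) => sn⁻¹))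
      (AN (Roots.ctr Lc) (n + 1))) μ y

/-- [our object — bookkeeping] **`Sd` OF p670056 §5 — THE READ-OUT WEIGHT OF THE RECORD**: `SRec cS n ν z κ y₀ := cS · wΦ (N := Lc^(n+2)) κ ν (y₀ − z)` (PART 46's column, the END's argument order). -/
def SRec (cS : ℝ) (n : ℕ) : Fin (3 + 1) → Site (3 + 1) → Fin (3 + 1) → Site (3 + 1) → ℝ :=
  fun ν z κ y₀ => cS * wΦ (N := Lc ^ (n + 1 + 1)) κ ν (y₀ - z)

/-- [our object — bookkeeping] **THE TABLE RECORD AT THE DOOR's DEPTH** — v10's `tabsComp (n+2) … (Pn.cM (n+2))` (`hM₂`, (T2)'s `Ĉ`). -/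
def tabsRec (Pn : Pins) (n : ℕ) : SymTables 3 (Lc ^ (n + 1 + 1)) :=
  tabsComp (n + 1 + 1) (Nat.one_le_iff_ne_zero.mpr (NeZero.ne Lc)) (Roots.ctr Lc).hr (Pn.cM (n + 1 + 1))

/-- [our object — bookkeeping] **THE DOOR FUNCTIONAL's WEIGHT OF THE RECORD at the window `(0, κ)`**: `omegaRec … κ u := tadpole (AN ρc (n+1)) (defKerZ (Lc^(n+2)) (tabsRec n) κ₂ (Pi.single u 1) (0, κ))`
(PART 67: the functional is its `ℓ¹` pairing; PART 68: the window `(y, κ)` reads `omegaRec (· − L•y)`). -/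
def omegaRec (Pn : Pins) (κ₂ : ℝ) (n : ℕ) (κ : Fin (3 + 1)) (u : Site (3 + 1)) : ℝ :=
  tadpole (AN (Roots.ctr Lc) (n + 1)) (defKerZ (Lc ^ (n + 1 + 1)) (tabsRec Lc Pn n) κ₂ (Pi.single u (1 : ℝ)) ((0 : Site (3 + 1)), κ))

/-- [our object — bookkeeping] **`𝒲Δ` OF v10 — THE DOOR FAMILY OF THE RECORD**, indexed by the door index `j`: `0` at `j = 0` (no door below the first storey), and at `j = n+1` PART 62's `doorZ` over
the record's tables, v10's scalars `κ₂ n` and `κτ n`, the record gauge functions `lamRec (sn n) n` and read-out weights `SRec (cS n) n`. -/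
def doorRec (Pn : Pins) (sn cS κ₂ κτ : ℕ → ℝ) : ℕ → Fin (3 + 1) → Site (3 + 1) → Fin (3 + 1) → Site (3 + 1) → MKer (3 + 1) (Fib 3)
  | 0 => fun _ _ _ _ _ _ _ _ => 0
  | n + 1 => doorZ (Lc ^ (n + 1 + 1)) (tabsRec Lc Pn n) (κ₂ n) (κτ n) (lamRec Lc (sn n) n) (SRec Lc (cS n) n)

end Defs

/-! ## §2 Unfoldings and v10's three `ff`∕swap letters at the instance -/

section Letters

variable (Lc : ℕ) [NeZero Lc] (Pn : Pins) (sn cS κ₂ κτ : ℕ → ℝ)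

/-- [folklore] no door at index `0` (`rfl`). -/
theorem doorRec_zero (μ : Fin (3 + 1)) (y : Site (3 + 1)) (ν : Fin (3 + 1)) (y' : Site (3 + 1)) :
    doorRec Lc Pn sn cS κ₂ κτ 0 μ y ν y' = fun _ _ _ _ => 0 := rfl

/-- [folklore] the door at index `n+1` is PART 62's `doorZ` over the record's letters (`rfl`). -/
theorem doorRec_succ (n : ℕ) : doorRec Lc Pn sn cS κ₂ κτ (n + 1)
    = doorZ (Lc ^ (n + 1 + 1)) (tabsRec Lc Pn n) (κ₂ n) (κτ n) (lamRec Lc (sn n) n) (SRec Lc (cS n) n) := rfl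

/-- [folklore] **v10's `hWΔm` AT THE INSTANCE**: the record door has no left multiplier leg, at every door index. -/
theorem doorRec_inr_left (j : ℕ) (μ : Fin (3 + 1)) (y : Site (3 + 1)) (ν : Fin (3 + 1)) (y' : Site (3 + 1)) (x w : Site (3 + 1)) (m : Fin (3 + 1)) (b : Fib 3) :
    doorRec Lc Pn sn cS κ₂ κτ j μ y ν y' x w (Sum.inr m) b = 0 := by
  cases j with
  | zero => rfl
  | succ n => exact doorZ_inr_left _ _ _ _ _ _ μ y ν y' x w m b

/-- [folklore] **v10's `hWΔm′` AT THE INSTANCE**: the record door has no right multiplier leg, at every door index. -/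
theorem doorRec_inr_right (j : ℕ) (μ : Fin (3 + 1)) (y : Site (3 + 1)) (ν : Fin (3 + 1)) (y' : Site (3 + 1)) (x w : Site (3 + 1)) (a : Fib 3) (m : Fin (3 + 1)) :
    doorRec Lc Pn sn cS κ₂ κτ j μ y ν y' x w a (Sum.inr m) = 0 := by
  cases j with
  | zero => rfl
  | succ n => exact doorZ_inr_right _ _ _ _ _ _ μ y ν y' x w a m

/-- [folklore] **v10's `hWΔs` AT THE INSTANCE**: the record door is symmetric under the exchange of its two sources, at every door index. -/
theorem doorRec_swap (j : ℕ) (μ : Fin (3 + 1)) (y : Site (3 + 1)) (ν : Fin (3 + 1)) (y' : Site (3 + 1)) :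
    doorRec Lc Pn sn cS κ₂ κτ j ν y' μ y = doorRec Lc Pn sn cS κ₂ κτ j μ y ν y' := by
  cases j with
  | zero => rfl
  | succ n => exact doorZ_swap _ _ _ _ _ _ μ y ν y'

end Letters

end Summit.QuantumFields.BalabanUV.Beta.FP.TowerDoorRecordDefs

end
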